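import Summits.HubbardSuperconductivity.HubbardSuperconductivity.Theses.WidthHaldane

/-!
# Route `WidthHaldane`: the assembly item `Assembly` (stmt-HubbardSuperconductivity-15602)

`WidthHaldaneBridge → WidthUniformThermodynamics → HubbardSuperconductivity` is literally the type of the route's
kernel-checked deciding theorem `Theses.WidthHaldane.closes` (crux-only deciding theorem, route repair
2026-08-16); this file records it under `Theorems/` so the item can be closed.  Pure logic; no definition is
introduced.
-/

set_option linter.dupNamespace false

namespace Summit.HubbardSuperconductivity.HubbardSuperconductivity.Theorems.WidthHaldane

/-- **Route WidthHaldane's `Assembly` holds** (item `stmt-HubbardSuperconductivity-15602`): the composition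
`WidthHaldaneBridge → WidthUniformThermodynamics → HubbardSuperconductivity` is the route's deciding theorem
`closes`. [folklore] -/
theorem widthHaldane_assembly_proof :
    Summit.HubbardSuperconductivity.HubbardSuperconductivity.Theses.WidthHaldane.Assembly :=
  fun h1 h2 => Summit.HubbardSuperconductivity.HubbardSuperconductivity.Theses.WidthHaldane.closes h1 h2

end Summit.HubbardSuperconductivity.HubbardSuperconductivity.Theorems.WidthHaldane
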